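import Literature.NumberTheory.GaloisRepresentations.SemiLocalArchimedeanShapiro
import Literature.NumberTheory.GaloisRepresentations.IdeleCohomologyLimit
import Literature.Algebra.Homology.ShapiroExplicit
import Literature.Algebra.Homology.CoinducedConjugation
import Mathlib.NumberTheory.NumberField.Completion.Ramification
import Mathlib.NumberTheory.NumberField.Completion.LiesOverInstances
import HarnessLib

/-!
# The decomposition group at an infinite place IS the Galois group of the completed extension:
# `Stab(w₀) ≃* Gal(E_{w₀}/F_v)`, `E_{w₀}/F_v` Galois of degree `n_v ∈ {1,2}`; the archimedean Shapiro component of a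
# principal class is its restriction to `Stab(w₀)` (Tate, C–F VII §1.1, §7.2; Harari §13.1)

Topic `NumberTheory/GaloisRepresentations`; namespace `Literature.NumberTheory.GaloisRepresentations.ArchHerbrand`
(continuing door-c5's `SemiLocalArchimedeanShapiro`: `archLocalUnitsRep w₀` = `E_{w₀}ˣ` as a `Stab(w₀)`-module,
`groupCohomologyArchUnitsRepIso w₀ n : Hⁿ(G, ∏_{w∣v} E_wˣ) ≅ Hⁿ(Stab(w₀), E_{w₀}ˣ)`).  Definitions with bodies and theorems;
NO named fact, no `sorry`, no instance, no notation; number fields in `Type`.  The archimedean twin of door-c5's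
`SemiLocalShapiro` §1 (`decompMulEquiv w : G_w ≃* Gal(E_w/F_v)`, `isGalois_place`) and of door-c6 g12's
`IdeleBrauerLocalInvariantsDictionary` §1 (`shapiro_placeProj_principal`), written so that the archimedean local
invariants of door-c5 (`localInvInfAt w₀`) can be compared with THE archimedean invariant maps of the tree
(`archimedeanInvariantMap`) through door-c6's `unitsAbsInfTwo F_v E_{w₀}` (next file).

Setting: `E/F` finite Galois extension of number fields, `w₀` an infinite place of `E` over the infinite place `v` of `F`
(`[w₀.1.LiesOver v.1]`, which makes Mathlib's scoped `NumberField.LiesOver` algebra structure `F_v → E_{w₀}`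
(`completionMap`) available; for `v = w₀.comap (algebraMap F E)` the instance is `⟨rfl⟩`).

* §1 `galInfiniteCompletionMap_algebraMap` (the transport `g_{w₀} : E_{w₀} → E_{w₀}` of `g ∈ Stab(w₀)` is `F_v`-linear — by
  density of `F`), `archDecompAlgEquiv`, **`archDecompHom w₀ : Stab(w₀) →* Gal(E_{w₀}/F_v)`**, `archDecompHom_injective`,
  `finrank_completion_eq_natCard_stabilizer` (`[E_{w₀}:F_v] = #Stab(w₀)`, Mathlib `finrank_eq_two_of_isRamified` /
  `finrank_eq_one_of_isUnramified`), `finiteDimensional_completion`, **`archDecompMulEquiv`** (bijective),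
  **`isGalois_completion`**.
* §2 `groupCohomologyArchLocalUnitsRepIsoAut w₀ n : Hⁿ(Stab(w₀), E_{w₀}ˣ) ≅ Hⁿ(Gal(E_{w₀}/F_v), E_{w₀}ˣ)` (Mathlib
  `groupCohomology.mapIso`; the modules agree), `archDecompIncl`, `unitsToInfPlaceHom`,
  **`shapiroArch_infPlaceProj_principal`**: `IsoAut ∘ Sh_{w₀} ∘ Hⁿ(π_∞,v) ∘ Hⁿ(Eˣ → J_E) = Hⁿ(archDecompIncl w₀, E ⊆ E_{w₀})`.

HONEST FRAMING: bookkeeping (Tate VII §1.1 at the archimedean places); no case of BSD / Poitou–Tate is proved.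

## References
* J. W. S. Cassels, A. Fröhlich (eds.), *Algebraic Number Theory* (1967), Ch. VII (Tate) §1.1, §7.2. [CasselsFrohlichANT1967]
* D. Harari, *Galois Cohomology and Class Field Theory* (2020), §13.1 Prop. 13.1 (b). [Harari2020]
* K. S. Brown, *Cohomology of Groups*, GTM 87 (1982), III (5.8), (6.2). [Brown1982CohomologyGroups]
-/

noncomputable section

open NumberField NumberField.InfinitePlace CategoryTheory CategoryTheory.Limits groupCohomology
open Literature.NumberTheory.Automorphic
open scoped NumberField.LiesOver

namespace Literature.NumberTheory.GaloisRepresentations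

namespace ArchHerbrand

open Literature.Algebra.Homology

variable {F : Type} [Field F] {E : Type} [Field E] [Algebra F E]
variable (v : InfinitePlace F) (w₀ : InfinitePlace E) [hL : w₀.1.LiesOver v.1]

/-! ## §1. `Stab(w₀) ≃* Gal(E_{w₀}/F_v)` -/

/-- **The transport `g_{w₀} : E_{w₀} → E_{w₀}` of `g ∈ Stab(w₀)` is `F_v`-linear** (it fixes `F ⊆ E`, hence `F_v` by density and
continuity). [cite: CasselsFrohlichANT1967, Ch. VII §1.1] -/
theorem galInfiniteCompletionMap_algebraMap (g : MulAction.stabilizer (E ≃ₐ[F] E) w₀) (x : v.Completion) :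
    galInfiniteCompletionMap (g : E ≃ₐ[F] E) (coe_stabilizer_smul w₀ g) (algebraMap v.Completion w₀.Completion x) =
      algebraMap v.Completion w₀.Completion x := by
  induction x using InfinitePlace.Completion.induction_on with
  | hp =>
    exact isClosed_eq ((continuous_galInfiniteCompletionMap F _ _).comp NumberField.LiesOver.continuous_completionMap)
      NumberField.LiesOver.continuous_completionMap
  | ih a =>
    rw [InfinitePlace.Completion.algebraMap_coe]
    change galInfiniteCompletionMap (g : E ≃ₐ[F] E) (coe_stabilizer_smul w₀ g)
      ((algebraMap F E a.ofAbs : E) : w₀.Completion) = ((algebraMap F E a.ofAbs : E) : w₀.Completion)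
    rw [galInfiniteCompletionMap_coe, AlgEquiv.commutes]

/-- **`g ∈ Stab(w₀)` acts on `E_{w₀}` by an `F_v`-algebra automorphism.** [cite: CasselsFrohlichANT1967, Ch. VII §1.1] -/
def archDecompAlgEquiv (g : MulAction.stabilizer (E ≃ₐ[F] E) w₀) : w₀.Completion ≃ₐ[v.Completion] w₀.Completion :=
  AlgEquiv.ofRingEquiv (f := galInfiniteCompletionEquiv (g : E ≃ₐ[F] E) (coe_stabilizer_smul w₀ g))
    fun x => galInfiniteCompletionMap_algebraMap v w₀ g x

/-- `archDecompAlgEquiv v w₀ g` is `galInfiniteCompletionMap g` as a function. [cite: CasselsFrohlichANT1967, Ch. VII §1.1] -/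
@[simp] theorem archDecompAlgEquiv_apply (g : MulAction.stabilizer (E ≃ₐ[F] E) w₀) (y : w₀.Completion) :
    archDecompAlgEquiv v w₀ g y = galInfiniteCompletionMap (g : E ≃ₐ[F] E) (coe_stabilizer_smul w₀ g) y := rfl

/-- **`Stab(w₀) →* Gal(E_{w₀}/F_v)`, `g ↦ g_{w₀}`.** [cite: CasselsFrohlichANT1967, Ch. VII §1.1] -/
def archDecompHom : MulAction.stabilizer (E ≃ₐ[F] E) w₀ →* (w₀.Completion ≃ₐ[v.Completion] w₀.Completion) where
  toFun := archDecompAlgEquiv v w₀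
  map_one' := AlgEquiv.ext fun y => by
    rw [archDecompAlgEquiv_apply, AlgEquiv.one_apply]
    exact (galInfiniteCompletionMap_congr_left F (OneMemClass.coe_one _) _ (one_smul _ _) y).trans
      (galInfiniteCompletionMap_one F _ y)
  map_mul' g g' := AlgEquiv.ext fun y => by
    rw [archDecompAlgEquiv_apply, AlgEquiv.mul_apply, archDecompAlgEquiv_apply, archDecompAlgEquiv_apply,
      galInfiniteCompletionMap_galInfiniteCompletionMap]
    exact galInfiniteCompletionMap_congr_left F (Subgroup.coe_mul _ g g') _ _ y

/-- `archDecompHom v w₀ g = archDecompAlgEquiv v w₀ g`. [cite: CasselsFrohlichANT1967, Ch. VII §1.1] -/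
@[simp] theorem archDecompHom_apply (g : MulAction.stabilizer (E ≃ₐ[F] E) w₀) :
    archDecompHom v w₀ g = archDecompAlgEquiv v w₀ g := rfl

/-- **`Stab(w₀) → Gal(E_{w₀}/F_v)` is injective** (an element acting trivially on `E_{w₀}` acts trivially on `E`).
[cite: CasselsFrohlichANT1967, Ch. VII §1.1] -/
theorem archDecompHom_injective : Function.Injective (archDecompHom v w₀) := by
  refine (injective_iff_map_eq_one _).mpr fun g hg => Subtype.ext (AlgEquiv.ext fun x => ?_)
  have h := AlgEquiv.congr_fun hg (x : w₀.Completion)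
  rw [archDecompHom_apply, archDecompAlgEquiv_apply, galInfiniteCompletionMap_coe, AlgEquiv.one_apply] at h
  have h' := congrArg (Completion.extensionEmbedding w₀) h
  rw [extensionEmbedding_coe', extensionEmbedding_coe'] at h'
  exact w₀.embedding.injective h'

variable [FiniteDimensional F E]

omit [FiniteDimensional F E] in
/-- **`[E_{w₀} : F_v] = #Stab(w₀)`** (`= 2` at a ramified, `= 1` at an unramified infinite place).
[cite: CasselsFrohlichANT1967, Ch. VII §1.1] -/
theorem finrank_completion_eq_natCard_stabilizer [IsGalois F E] :
    Module.finrank v.Completion w₀.Completion = Nat.card (MulAction.stabilizer (E ≃ₐ[F] E) w₀) := by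
  by_cases h : w₀.IsUnramified F
  · rw [Completion.finrank_eq_one_of_isUnramified v h, (isUnramified_iff_card_stabilizer_eq_one.1 h)]
  · rw [Completion.finrank_eq_two_of_isRamified v h, (isRamified_iff_card_stabilizer_eq_two.1 h)]

/-- `E_{w₀}` is finite-dimensional over `F_v`. [cite: CasselsFrohlichANT1967, Ch. VII §1.1] -/
theorem finiteDimensional_completion [IsGalois F E] : FiniteDimensional v.Completion w₀.Completion :=
  Module.finite_of_finrank_pos (by rw [finrank_completion_eq_natCard_stabilizer v w₀]; exact Nat.card_pos)

/-- **`#Gal(E_{w₀}/F_v) = #Stab(w₀)`** (`≥` by the injection, `≤ [E_{w₀}:F_v]`). [cite: CasselsFrohlichANT1967, Ch. VII §1.1] -/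
theorem natCard_algEquiv_completion [IsGalois F E] :
    Nat.card (w₀.Completion ≃ₐ[v.Completion] w₀.Completion) = Nat.card (MulAction.stabilizer (E ≃ₐ[F] E) w₀) := by
  haveI := finiteDimensional_completion v w₀
  refine le_antisymm ?_ (Nat.card_le_card_of_injective _ (archDecompHom_injective v w₀))
  rw [← finrank_completion_eq_natCard_stabilizer v w₀, Nat.card_eq_fintype_card]
  exact AlgEquiv.card_le

/-- **`Stab(w₀) ≃* Gal(E_{w₀}/F_v)`** (Tate VII §1.1 at an archimedean place). [cite: CasselsFrohlichANT1967, Ch. VII §1.1] -/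
def archDecompMulEquiv [IsGalois F E] :
    MulAction.stabilizer (E ≃ₐ[F] E) w₀ ≃* (w₀.Completion ≃ₐ[v.Completion] w₀.Completion) :=
  haveI := finiteDimensional_completion v w₀
  MulEquiv.ofBijective (archDecompHom v w₀)
    ((Nat.bijective_iff_injective_and_card _).mpr ⟨archDecompHom_injective v w₀, (natCard_algEquiv_completion v w₀).symm⟩)

/-- `archDecompMulEquiv v w₀ g = archDecompAlgEquiv v w₀ g`. [cite: CasselsFrohlichANT1967, Ch. VII §1.1] -/
@[simp] theorem archDecompMulEquiv_apply [IsGalois F E] (g : MulAction.stabilizer (E ≃ₐ[F] E) w₀) :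
    archDecompMulEquiv v w₀ g = archDecompAlgEquiv v w₀ g := rfl

/-- **`E_{w₀}/F_v` is Galois** (`#Aut = [E_{w₀}:F_v]`). [cite: CasselsFrohlichANT1967, Ch. VII §1.1] -/
theorem isGalois_completion [IsGalois F E] : IsGalois v.Completion w₀.Completion := by
  haveI := finiteDimensional_completion v w₀
  exact IsGalois.of_card_aut_eq_finrank _ _
    ((natCard_algEquiv_completion v w₀).trans (finrank_completion_eq_natCard_stabilizer v w₀).symm)

/-! ## §2. The `Stab(w₀)`-module `E_{w₀}ˣ` through `Gal(E_{w₀}/F_v)`; the Shapiro component of a principal class -/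

/-- **`Hⁿ(Stab(w₀), E_{w₀}ˣ) ≅ Hⁿ(Gal(E_{w₀}/F_v), E_{w₀}ˣ)`** along `archDecompMulEquiv` (door-c5's `archLocalUnitsRep w₀` and
Mathlib's `Rep.ofAlgebraAutOnUnits F_v E_{w₀}` have the same underlying module and the same action).
[cite: CasselsFrohlichANT1967, Ch. VII §1.1][cite: Harari2020, §13.1 Prop. 13.1 (b)] -/
def groupCohomologyArchLocalUnitsRepIsoAut [IsGalois F E] (n : ℕ) :
    groupCohomology (archLocalUnitsRep (F := F) w₀) n ≅
      groupCohomology (Rep.ofAlgebraAutOnUnits v.Completion w₀.Completion) n :=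
  groupCohomology.mapIso (archDecompMulEquiv v w₀) (LinearEquiv.refl ℤ _)
    (fun _ => LinearMap.ext fun _ => Additive.toMul.injective (Units.ext rfl)) n

/-- **`Gal(E_{w₀}/F_v) ↪ Gal(E/F)`** (inverse of `archDecompMulEquiv`, then the inclusion of `Stab(w₀)`).
[cite: CasselsFrohlichANT1967, Ch. VII §1.1] -/
def archDecompIncl [IsGalois F E] : (w₀.Completion ≃ₐ[v.Completion] w₀.Completion) →* (E ≃ₐ[F] E) :=
  (MulAction.stabilizer (E ≃ₐ[F] E) w₀).subtype.comp (archDecompMulEquiv v w₀).symm.toMonoidHom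

/-- `archDecompIncl g` acts on `E ⊆ E_{w₀}` as `g`. [cite: CasselsFrohlichANT1967, Ch. VII §1.1] -/
theorem coe_archDecompIncl_apply [IsGalois F E] (g : w₀.Completion ≃ₐ[v.Completion] w₀.Completion) (x : E) :
    ((archDecompIncl v w₀ g x : E) : w₀.Completion) = g (x : w₀.Completion) := by
  have h : archDecompAlgEquiv v w₀ ((archDecompMulEquiv v w₀).symm g) (x : w₀.Completion) =
      (((((archDecompMulEquiv v w₀).symm g : MulAction.stabilizer (E ≃ₐ[F] E) w₀) : E ≃ₐ[F] E) x : E) : w₀.Completion) := by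
    rw [archDecompAlgEquiv_apply, galInfiniteCompletionMap_coe]
  rw [← archDecompMulEquiv_apply, MulEquiv.apply_symm_apply] at h
  exact h.symm

/-- **`Eˣ → E_{w₀}ˣ` as a morphism `Res_{archDecompIncl} (Eˣ) ⟶ E_{w₀}ˣ`** of `Gal(E_{w₀}/F_v)`-modules.
[cite: CasselsFrohlichANT1967, Ch. VII §1.1][cite: SerreGaloisCohomology1997, Ch. I §2.4] -/
def unitsToInfPlaceHom [IsGalois F E] :
    Rep.res (archDecompIncl v w₀) (Rep.ofAlgebraAutOnUnits F E) ⟶ Rep.ofAlgebraAutOnUnits v.Completion w₀.Completion :=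
  Rep.ofHom ⟨(MonoidHom.toAdditive (Units.map (algebraMap E w₀.Completion : E →* w₀.Completion))).toIntLinearMap,
    fun g => by
      apply LinearMap.ext
      intro x
      refine Additive.toMul.injective (Units.ext ?_)
      exact coe_archDecompIncl_apply v w₀ g ((Additive.toMul x : Eˣ) : E)⟩

/-- Unfolding `unitsToInfPlaceHom` on a unit. [cite: CasselsFrohlichANT1967, Ch. VII §1.1] -/
theorem unitsToInfPlaceHom_hom_ofMul [IsGalois F E] (u : Eˣ) :
    (unitsToInfPlaceHom v w₀).hom (Additive.ofMul u) =
      Additive.ofMul (Units.map (algebraMap E w₀.Completion : E →* w₀.Completion) u) := rfl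

/-- **The archimedean Shapiro component of a principal class is its restriction to the decomposition group**:
`IsoAut ∘ Sh_{w₀} ∘ Hⁿ(π_{∞,v}) ∘ Hⁿ(Eˣ → J_E) = Hⁿ(archDecompIncl w₀, E ⊆ E_{w₀})`, `v = w₀|_F` (door-c5's Shapiro isomorphism is
`coindIso ∘ H(recognition)`, Mathlib's `coindIso` is restriction + evaluation at `1`, and the `w₀`-component of the cut-off principal
idèle of `x` is `x ∈ E_{w₀}`). [cite: CasselsFrohlichANT1967, Ch. VII §7.2][cite: Brown1982CohomologyGroups, III (6.2)] -/
theorem shapiroArch_infPlaceProj_principal [NumberField E] [IsGalois F E] [Fintype (E ≃ₐ[F] E)] (n : ℕ) :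
    groupCohomology.map (MonoidHom.id _) (IdeleClassGroup.principalRepHom F E) n ≫
        groupCohomology.map (MonoidHom.id _) (IdeleCohomology.infPlaceProj (E := E) (w₀.comap (algebraMap F E))) n ≫
          (groupCohomologyArchUnitsRepIso (F := F) w₀ n).hom ≫ (groupCohomologyArchLocalUnitsRepIsoAut v w₀ n).hom =
      groupCohomology.map (archDecompIncl v w₀) (unitsToInfPlaceHom v w₀) n := by
  rw [groupCohomologyArchUnitsRepIso, Iso.trans_hom, Iso.trans_hom, Functor.mapIso_hom, coindIso_hom_eq,
    groupCohomologyArchLocalUnitsRepIsoAut, groupCohomology.mapIso_hom, groupCohomology.mapIso_hom]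
  change groupCohomology.map (MonoidHom.id _) _ n ≫ groupCohomology.map (MonoidHom.id _) _ n ≫
      groupCohomology.map (MonoidHom.id _) _ n ≫ groupCohomology.map _ _ n ≫ groupCohomology.map _ _ n ≫
        groupCohomology.map _ _ n = _
  rw [← Category.assoc, ← groupCohomology.map_id_comp, ← Category.assoc, ← groupCohomology.map_id_comp,
    ← Category.assoc, ← groupCohomology.map_comp, ← Category.assoc, ← groupCohomology.map_comp, ← groupCohomology.map_comp]
  refine map_congr' (MonoidHom.ext fun _ => rfl) _ _ (fun x => ?_) n
  refine Additive.toMul.injective (Units.ext ?_)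
  change ((Additive.toMul (archProj (E := E) (w₀.comap (algebraMap F E))
      ((basePt (F := F) w₀ : MulAction.orbit (E ≃ₐ[F] E) w₀) : InfinitePlace E)
      (archUnitsRepr (E := E) (w₀.comap (algebraMap F E)) 1
        (Additive.ofMul (cutoff E (w₀.comap (algebraMap F E))
          (IdeleHerbrand.infHom E (IdeleHerbrand.principal E (Additive.toMul x : Eˣ))))))) : (w₀.Completion)ˣ) :
        w₀.Completion) = (((Additive.toMul x : Eˣ) : E) : w₀.Completion)
  rw [map_one, Module.End.one_apply, coe_toMul_archProj, toMul_ofMul,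
    coe_cutoff_apply_of_isOver _ (rfl : IsOver E (w₀.comap (algebraMap F E)) w₀)]
  rfl

end ArchHerbrand

end Literature.NumberTheory.GaloisRepresentations

end
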